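import Summits.MatrixMultiplication.OmegaCensus.BoxBadAtomsSmallQ

/-!
# ω-census, family (b3): conjecture C9 (b) reduced to two families — the Schmidt atoms `A(p,q)`, `q ≥ 5`, and the finite simple groups

HONEST FRAMING (pub-omega census; verbatim): lottery ticket; floor = certified bounds/negative ranges.
Census BOOKKEEPING (conjecture C9 of the cell, STRUCTURE.md §2, `BoxRatioSectionLaw`; pub-omega kernel-l4 gen 17, task K-5″).
Nothing here is progress on `ω`.

* `not_boxUseful_of_not_isSolvable` — if every finite non-abelian SIMPLE group is box-useless, then so is every finite
  non-solvable group (induction on the order: a non-solvable group is simple non-abelian, or has a proper non-trivial normal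
  subgroup `N` with `N` or `G/N` non-solvable — `solvable_of_ker_le_range` — and box-uselessness ascends from subgroups and
  quotients, C9 (a)).
* **`boxRatioSectionLaw_of_atomBad_five_of_simple`** — `BoxRatioSectionLaw` (C9 (b) for every finite group) follows from two
  family statements, both predicted by C9 (b) itself: (A) every finite group carrying an `AtomConfig p q` with `p ≠ q` primes,
  `q ≥ 5`, is box-useless (the Schmidt atoms `A(p,q) = 𝔽_{p^k} ⋊ μ_q`, `q ≥ 5`, in relation form — the cell's open atom lane);
  (S) every finite non-abelian simple group is box-useless.  What the tree has towards (S): `A₄`-, `D_{2p}`- and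
  Frobenius-configurations are box-useless in any group (`KleinRot`, `not_boxUseful_of_inverted`, …), so e.g. every simple group
  containing `A₄` or a dihedral `D_{2p}`, `p ≥ 5`, is covered; a classification-free proof of (S) is not claimed.
-/

namespace Summit.MatrixMultiplication.OmegaCensus

universe u

/-- **Non-solvable reduces to simple.** If every finite non-abelian simple group is box-useless, then every finite
non-solvable group is box-useless. [folklore] -/
theorem not_boxUseful_of_not_isSolvable
    (hS : ∀ (S : Type u) [Group S] [Fintype S] [DecidableEq S], IsSimpleGroup S → (∃ a b : S, a * b ≠ b * a) →
      ¬ BoxUseful S) :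
    ∀ (n : ℕ) (G : Type u) [Group G] [Fintype G] [DecidableEq G], Fintype.card G = n → ¬ IsSolvable G → ¬ BoxUseful G := by
  intro n
  induction n using Nat.strong_induction_on with
  | _ n IH =>
  intro G _ _ _ hn hG hGu
  classical
  -- `G` is non-trivial and non-abelian
  have hcomm : ∃ a b : G, a * b ≠ b * a := by
    by_contra! h
    exact hG (isSolvable_of_comm h)
  haveI : Nontrivial G := by
    obtain ⟨a, b, hab⟩ := hcomm
    by_contra htriv
    haveI : Subsingleton G := not_nontrivial_iff_subsingleton.1 htriv
    exact hab (Subsingleton.elim _ _)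
  by_cases hsimple : ∀ N : Subgroup G, N.Normal → N = ⊥ ∨ N = ⊤
  · exact hS G ⟨hsimple⟩ hcomm hGu
  · push Not at hsimple
    obtain ⟨N, hNn, hNbot, hNtop⟩ := hsimple
    haveI := hNn
    -- `N` or `G / N` is non-solvable
    by_cases hNs : IsSolvable N
    · have hQ : ¬ IsSolvable (G ⧸ N) := by
        intro hQs
        exact hG (solvable_of_ker_le_range N.subtype (QuotientGroup.mk' N)
          (by rw [QuotientGroup.ker_mk', Subgroup.range_subtype]))
      have hlt : Fintype.card (G ⧸ N) < n := by
        rw [← hn, ← Nat.card_eq_fintype_card, ← Nat.card_eq_fintype_card,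
          Subgroup.card_eq_card_quotient_mul_card_subgroup N]
        exact lt_mul_of_one_lt_right Nat.card_pos (N.one_lt_card_iff_ne_bot.2 hNbot)
      exact IH _ hlt (G ⧸ N) rfl hQ (hGu.quotient N)
    · have hlt : Fintype.card N < n := by
        rw [← hn, ← Nat.card_eq_fintype_card, ← Nat.card_eq_fintype_card, ← N.card_mul_index]
        exact lt_mul_of_one_lt_right Nat.card_pos (Subgroup.one_lt_index_of_ne_top hNtop)
      exact IH _ hlt N rfl hNs (hGu.subgroup N)

/-- **Conjecture C9 (b) reduced to two families.** `BoxRatioSectionLaw` holds provided (A) every finite group carrying an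
`AtomConfig p q` with `p ≠ q` primes and `q ≥ 5` is box-useless (the Schmidt atoms `A(p,q)`, `q ≥ 5`) and (S) every finite
non-abelian simple group is box-useless. [folklore] -/
theorem boxRatioSectionLaw_of_atomBad_five_of_simple
    (hAtom : ∀ p q : ℕ, p.Prime → q.Prime → p ≠ q → 5 ≤ q → AtomBad.{0} p q)
    (hS : ∀ (S : Type) [Group S] [Fintype S] [DecidableEq S], IsSimpleGroup S → (∃ a b : S, a * b ≠ b * a) →
      ¬ BoxUseful S) :
    BoxRatioSectionLaw :=
  boxRatioSectionLaw_of_atomBad_five_of_nonsolvable hAtom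
    (fun H _ _ _ hH => not_boxUseful_of_not_isSolvable hS (Fintype.card H) H rfl hH)

end Summit.MatrixMultiplication.OmegaCensus
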